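import Literature.MathematicalPhysics.QuantumFieldTheory.Balaban1983to89.B9Eq3104CommutatorGradFormDD
import Literature.MathematicalPhysics.QuantumFieldTheory.Balaban1983to89.B9Eq3104CutoffCommutatorSizes
import Literature.MathematicalPhysics.QuantumFieldTheory.Balaban1983to89.B6Partition118KLevelFineMixed

/-!
# `Balaban1983to89.B9Eq3104CommutatorSizesDD` — T. Bałaban, *Propagators for lattice gauge theories in a background field*,
# Commun. Math. Phys. **99** (1985) 389–434 [Balaban1985BackgroundPropagators], Sect. C p. 414 l. 1–3: «[DD*, h] … first order differential operators with
# coefficients determined by derivatives of the function h. They are of the order O(M⁻¹), or O(M⁻²), if considered on a proper scale» — THE PRINT-SHAPE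
# SIZE OF THE `DD*`-PIECE OF `K(h_□)(U)` AT THE COVER OF RECORD, IN GRADIENT FORM: against the local sups of the COMPONENTS of `A` and of their covariant
# FIRST differences near the bond (the bond-sector twin of this seat's `B9Thm37CubeCoverCommutatorSizesGrad`; module M5.7-est, file D′₁)

statement-level skeleton of published theorems with citation tags; proofs where landed; nothing here is a claim about the Yang–Mills mass gap

THE SIZES (all from the tree): one lattice step of `h_□`: `|h_□(z±e) − h_□(z)| ≤ C1F∕(8S_j∕5)` (this seat's `abs_hTY_shiftY_sub_le`); the unit step of a first
difference (pure or MIXED second difference): `≤ C2X∕(8S_j∕5)²` (p22's `B6Partition118KLevelFineMixed.abs_hT_diff_step_le`, [4] p.247 «|∇∇′h_□| ≤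
O(1)(MLʲη)⁻²»); the transporters are bi-contractions (`‖U‖, ‖U⁻¹‖ ≤ 1`, hypothesis `hU`); the PLAQUETTE HOLONOMY DEFECT `‖R(U(∂p))Y − Y‖ ≤ δ_P‖Y‖` is a
DISPLAYED hypothesis `hP` (zero at `U = 1`; on the class (3.35) small, [B9] p.396 — supplied by the class owner, not here).

## WHAT THIS FILE PROVES (THEOREMS only; 0 `def … : Prop`, 0 sorry)
* `abs_hTY_mixed_le` — the unit step of a first difference of `h_□` read on def-Y's carrier (p22's mixed second difference at `w = σ_μ⁻¹z`).
* `norm_grad_term_le` — the size of ONE summand of `B9Eq3104CommutatorGradFormDD.cdS_cdsS_cutMulY_apply_grad` at `h = h_□`: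
  `‖∇_ν∇*_μ(h_□Λ)(z) − h_□(z)∇_ν∇*_μΛ(z)‖ ≤ θ₁·‖∇*_μΛ(z+e_ν)‖ + θ₁·(‖∇_νΛ(z−e_μ)‖ + δ_P‖Λ(z−e_μ+e_ν)‖) + θ₂·‖Λ(z−e_μ)‖`,
  `θ₁ = C1F∕(8S_j∕5)`, `θ₂ = C2X∕(8S_j∕5)²`.
* ★★ `norm_cutCommR_gradY_divY_hTY_apply_le_grad` — **THE `DD*`-PIECE IN PRINT'S SHAPE**: for local bounds `G₀` (the components `A_μ` at `chart b₋ − e_μ`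
  and `chart b₋ − e_μ + e_ν`) and `G₁` (`∇_νA_μ` at `chart b₋ − e_μ`, `∇*_μA_μ` at `chart b₋ + e_ν`), `ν = b.dir`:
  `‖([h_□](∇_U∇*_U))A(b)‖ ≤ c_f²·(d+1)·(2θ₁·G₁ + (θ₁δ_P + θ₂)·G₀)` — (∂h)(∇A) + (∂²h + (∂h)·defect)(A): print's O(M⁻¹) ∕ O(M⁻²) «on a proper scale»
  (`θ₁ = (5∕8)C1F∕(L·M_h)·L^{−j}`, `θ₂ = (5∕8)²C2X∕(L·M_h)²·L^{−2j}`, this seat's `C1F_div_bigSide_eq` ∕ its C2X twin `C2X_div_bigSide_sq_eq`).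
HONEST SCOPE.  Sizes against LOCAL SUP DATA of `A` (the (3.42)-type cube bounds enter only in file E′); the Hessian-curl piece and the averaging pieces are
the sibling D′₂; nothing of Thm 3.10 ∕ 3.3 asserted; YM mass gap NOT proved by any of this (Track A conditional rung).  `--supports stmt-QuantumFields-19200`.
Net new unproved facts: 0.
-/

noncomputable section

namespace Literature.MathematicalPhysics.QuantumFieldTheory.Balaban1983to89.B9Eq3104CommutatorSizesDD

open Node00
open B9Thm37CubeCoverCommutators (cutMulY cutMulY_apply hTY hTY_apply)
open B9Thm37CubeCoverCommutatorSizes (side_conditions abs_hTY_shiftY_sub_le abs_hTY_shiftY_symm_sub_le)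
open B9Thm37CubeCoverCommutatorSizesGrad (C1F_div_bigSide_eq)
open B9Eq3104CutoffCommutators (cutCommR hBdY)
open B9Eq3104CommutatorGradFormDD (shiftY_symm_shiftY_comm shiftY_shiftY_symm shiftY_symm_shiftY cdS_cdsS_cutMulY_apply_grad
  cutCommR_gradY_divY_apply)
open B6KLevelCensusIndexV1 (KIdx)
open B6GlobalChartV1 (PV)
open B6MultiLevelBoxOperator (bigSide bigSide_eq one_le_bigSide)
open B6MultiLevelTorusOperator (tshift unitVec)
open B6Cover236MultiLevelBlocks (cubes)
open B6Partition118KLevelTorus (hT)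
open B6Partition118KLevelFineSizes (C1F C1F_nonneg)
open B6Partition118KLevelFineMixed (C2X C2X_bounds abs_hT_diff_step_le)
open Node00.OpsYNablaBridge (chartY bondCompY)
open B9Eq39Adjoint (R R_smul plaqU)
open B9Eq310Hermitian (norm_R_le)
open scoped Matrix

variable {𝔸 : Type} [NormedRing 𝔸] [NormedAlgebra ℂ 𝔸] [CompleteSpace 𝔸]
variable {d ℓ : ℕ} {hd : 1 ≤ d + 1} {hL : Odd (ℓ + 1) ∧ 1 < ℓ + 1} {b₀ b₁ : ℝ}
variable (i : KIdx d ℓ hd hL b₀ b₁)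

/-! ## §1 The second-difference size of `h_□` on def-Y's carrier and the level form of its constant -/

omit [NormedAlgebra ℂ 𝔸] [CompleteSpace 𝔸] in
/-- the unit step of a first difference of `h_□` on def-Y's carrier: `|(h_□(σ_νσ_μ⁻¹z) − h_□(σ_νz)) − (h_□(σ_μ⁻¹z) − h_□(z))| ≤ C2X∕(8S_j∕5)²` (p22's second
difference — pure or mixed — read at `w = σ_μ⁻¹z`). [cite: Balaban1984PropagatorsII, p.247 («|∇∇′h_□| ≤ O(1)(MLʲη)⁻²»); Balaban1985BackgroundPropagators, p.414 l.1–3] -/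
theorem abs_hTY_mixed_le (c : ↥(cubes i.D.toDomains)) (μ ν : Fin (d + 1)) (z : SiteY i) :
    |(hTY i c (shiftY i ν ((shiftY i μ).symm z)) - hTY i c (shiftY i ν z)) - (hTY i c ((shiftY i μ).symm z) - hTY i c z)|
      ≤ C2X d ℓ / (8 / 5 * (bigSide ℓ i.Mh c.1.1 : ℝ)) ^ 2 := by
  obtain ⟨hℓ, hMh, hR, hP5⟩ := side_conditions i
  have hs : shiftY i μ ((shiftY i μ).symm z) = z := shiftY_shiftY_symm i μ z
  have e := abs_hT_diff_step_le (DT := i.D) hℓ hMh hR hP5 c μ ν ((shiftY i μ).symm z)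
  change |hTY i c (shiftY i ν (shiftY i μ ((shiftY i μ).symm z))) - hTY i c (shiftY i μ ((shiftY i μ).symm z))
      - hTY i c (shiftY i ν ((shiftY i μ).symm z)) + hTY i c ((shiftY i μ).symm z)| ≤ _ at e
  rw [hs] at e
  have r : (hTY i c (shiftY i ν ((shiftY i μ).symm z)) - hTY i c (shiftY i ν z)) - (hTY i c ((shiftY i μ).symm z) - hTY i c z)
      = -(hTY i c (shiftY i ν z) - hTY i c z - hTY i c (shiftY i ν ((shiftY i μ).symm z)) + hTY i c ((shiftY i μ).symm z)) := by ring
  rw [r, abs_neg]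
  exact e

omit [NormedAlgebra ℂ 𝔸] [CompleteSpace 𝔸] in
/-- the second-difference constant in level form: `C2X∕(8S_j∕5)² = (5∕8)²·C2X∕(L·M_h)²·(L^{-j})²`. [cite: Balaban1985BackgroundPropagators, p.414 («O(M⁻²) … on a proper scale»)] -/
theorem C2X_div_bigSide_sq_eq (c : ↥(cubes i.D.toDomains)) :
    C2X d ℓ / (8 / 5 * (bigSide ℓ i.Mh c.1.1 : ℝ)) ^ 2
      = (5 / 8) ^ 2 * C2X d ℓ / ((((ℓ : ℝ) + 1) * i.Mh) ^ 2) * ((((ℓ : ℝ) + 1) ^ (c.1.1 : ℕ)) ^ 2)⁻¹ := by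
  have hS : (bigSide ℓ i.Mh c.1.1 : ℝ) = ((ℓ : ℝ) + 1) ^ (c.1.1 : ℕ) * (((ℓ : ℝ) + 1) * i.Mh) := by
    rw [bigSide_eq]; push_cast; ring
  have hL1 : (0 : ℝ) < ((ℓ : ℝ) + 1) ^ (c.1.1 : ℕ) := by positivity
  have hM : (0 : ℝ) < ((ℓ : ℝ) + 1) * i.Mh := by
    have := B9GeoLemma21KLevelV1.one_le_Mh i
    have : (1 : ℝ) ≤ i.Mh := by exact_mod_cast this
    positivity
  rw [hS]
  field_simp

/-! ## §2 The size of one gradient-form summand -/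

/-- **ONE SUMMAND OF THE `DD*`-PIECE IN GRADIENT FORM, SIZED**: with `θ₁ = C1F∕(8S_j∕5)`, `θ₂ = C2X∕(8S_j∕5)²`, bi-contractive transporters and the displayed
plaquette-holonomy defect `δ_P`:
`‖∇_ν∇*_μ(h_□Λ)(z) − h_□(z)•∇_ν∇*_μΛ(z)‖ ≤ θ₁‖∇*_μΛ(z+e_ν)‖ + θ₁(‖∇_νΛ(z−e_μ)‖ + δ_P‖Λ(z−e_μ+e_ν)‖) + θ₂‖Λ(z−e_μ)‖`.
[cite: Balaban1985BackgroundPropagators, p.414 l.1–3, (3.100) p.413, (3.7) p.391; Balaban1984PropagatorsII, p.247] -/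
theorem norm_grad_term_le (c : ↥(cubes i.D.toDomains)) (U : CfgY 𝔸 i)
    (hU : ∀ μ x, ‖(U μ x : 𝔸)‖ ≤ 1 ∧ ‖(((U μ x)⁻¹ : 𝔸ˣ) : 𝔸)‖ ≤ 1) {δP : ℝ} (hδP : 0 ≤ δP)
    (hP : ∀ (μ lam : Fin (d + 1)) (w : SiteY i) (Y : 𝔸), ‖R (plaqU (shiftY i) (UboxY i U) μ lam w) Y - Y‖ ≤ δP * ‖Y‖)
    (μ ν : Fin (d + 1)) (Λ : SiteY i → 𝔸) (z : SiteY i) :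
    ‖cdS i U ν (cdsS i U μ (cutMulY (hTY i c) Λ)) z - ((hTY i c z : ℝ) : ℂ) • cdS i U ν (cdsS i U μ Λ) z‖
      ≤ C1F d ℓ / (8 / 5 * (bigSide ℓ i.Mh c.1.1 : ℝ)) * ‖cdsS i U μ Λ (shiftY i ν z)‖
        + C1F d ℓ / (8 / 5 * (bigSide ℓ i.Mh c.1.1 : ℝ)) * (‖cdS i U ν Λ ((shiftY i μ).symm z)‖ + δP * ‖Λ (shiftY i ν ((shiftY i μ).symm z))‖)
        + C2X d ℓ / (8 / 5 * (bigSide ℓ i.Mh c.1.1 : ℝ)) ^ 2 * ‖Λ ((shiftY i μ).symm z)‖ := by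
  have hUb : ∀ μ (w : SiteY i), ‖(UboxY i U μ w : 𝔸)‖ ≤ 1 ∧ ‖(((UboxY i U μ w)⁻¹ : 𝔸ˣ) : 𝔸)‖ ≤ 1 := fun μ w => hU μ _
  have hRle : ∀ μ (w : SiteY i) (X : 𝔸), ‖R (UboxY i U μ w) X‖ ≤ ‖X‖ := fun μ w X => norm_R_le (hUb μ w).1 (hUb μ w).2 X
  have hRle' : ∀ μ (w : SiteY i) (X : 𝔸), ‖R (UboxY i U μ w)⁻¹ X‖ ≤ ‖X‖ :=
    fun μ w X => norm_R_le (hUb μ w).2 (by rw [inv_inv]; exact (hUb μ w).1) X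
  have hθ₁ : 0 ≤ C1F d ℓ / (8 / 5 * (bigSide ℓ i.Mh c.1.1 : ℝ)) := div_nonneg (C1F_nonneg d ℓ) (by positivity)
  rw [cdS_cdsS_cutMulY_apply_grad, add_assoc, add_assoc, add_sub_cancel_left]
  -- the three gradient-form terms
  have n1 : ‖((hTY i c (shiftY i ν z) - hTY i c z : ℝ) : ℂ) • R (UboxY i U ν z) (cdsS i U μ Λ (shiftY i ν z))‖
      ≤ C1F d ℓ / (8 / 5 * (bigSide ℓ i.Mh c.1.1 : ℝ)) * ‖cdsS i U μ Λ (shiftY i ν z)‖ := by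
    rw [norm_smul, Complex.norm_real, Real.norm_eq_abs]
    exact mul_le_mul (abs_hTY_shiftY_sub_le i c ν z) (hRle ν z _) (norm_nonneg _) hθ₁
  have n2 : ‖((hTY i c (shiftY i ν ((shiftY i μ).symm z)) - hTY i c (shiftY i ν z) : ℝ) : ℂ) • R (UboxY i U μ ((shiftY i μ).symm z))⁻¹
        (cdS i U ν Λ ((shiftY i μ).symm z)
          + (R (plaqU (shiftY i) (UboxY i U) μ ν ((shiftY i μ).symm z))
                (R (UboxY i U ν ((shiftY i μ).symm z)) (Λ (shiftY i ν ((shiftY i μ).symm z))))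
              - R (UboxY i U ν ((shiftY i μ).symm z)) (Λ (shiftY i ν ((shiftY i μ).symm z)))))‖
      ≤ C1F d ℓ / (8 / 5 * (bigSide ℓ i.Mh c.1.1 : ℝ)) * (‖cdS i U ν Λ ((shiftY i μ).symm z)‖ + δP * ‖Λ (shiftY i ν ((shiftY i μ).symm z))‖) := by
    rw [norm_smul, Complex.norm_real, Real.norm_eq_abs]
    have hc : (shiftY i μ).symm (shiftY i ν z) = shiftY i ν ((shiftY i μ).symm z) := shiftY_symm_shiftY_comm i μ ν z
    have hh : |hTY i c (shiftY i ν ((shiftY i μ).symm z)) - hTY i c (shiftY i ν z)| ≤ C1F d ℓ / (8 / 5 * (bigSide ℓ i.Mh c.1.1 : ℝ)) := by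
      rw [← hc]; exact abs_hTY_shiftY_symm_sub_le i c μ (shiftY i ν z)
    refine mul_le_mul hh ((hRle' μ _ _).trans ((norm_add_le _ _).trans (add_le_add le_rfl ?_))) (norm_nonneg _) hθ₁
    exact (hP μ ν _ _).trans (mul_le_mul_of_nonneg_left (hRle ν _ _) hδP)
  have n3 : ‖(((hTY i c (shiftY i ν ((shiftY i μ).symm z)) - hTY i c (shiftY i ν z)) - (hTY i c ((shiftY i μ).symm z) - hTY i c z) : ℝ) : ℂ)
        • R (UboxY i U μ ((shiftY i μ).symm z))⁻¹ (Λ ((shiftY i μ).symm z))‖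
      ≤ C2X d ℓ / (8 / 5 * (bigSide ℓ i.Mh c.1.1 : ℝ)) ^ 2 * ‖Λ ((shiftY i μ).symm z)‖ := by
    rw [norm_smul, Complex.norm_real, Real.norm_eq_abs]
    exact mul_le_mul (abs_hTY_mixed_le i c μ ν z) (hRle' μ _ _) (norm_nonneg _) (div_nonneg (C2X_bounds d ℓ).2.2 (by positivity))
  have s := (norm_add_le _ _).trans (add_le_add n1 ((norm_add_le _ _).trans (add_le_add n2 n3)))
  linarith [s]

/-! ## §3 The `DD*`-piece of `K(h_□)(U)` in print's shape -/

/-- ★★ **THE `DD*`-PIECE OF `K(h_□)(U) = [h_□, Δ_loc(U)]` IN PRINT'S SHAPE — p. 414 l. 1–3.**  For the cut-off `h_□` of the cover of record, bi-contractive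
transporters, the displayed plaquette-holonomy defect `δ_P ≥ 0`, and local bounds at the bond `b` (`ν = b.dir`, `x = chart b₋`): `G₀ ≥ ‖A_μ(x − e_μ)‖,
‖A_μ(x − e_μ + e_ν)‖` and `G₁ ≥ ‖(∇_νA_μ)(x − e_μ)‖, ‖(∇*_μA_μ)(x + e_ν)‖` for every `μ` (components `A_μ = bondCompY μ A`, lattice-unit covariant
differences `cdS`∕`cdsS`):
`‖([h_□](∇_U ∘ ∇*_U))A(b)‖ ≤ c_f²·(d+1)·(2θ₁·G₁ + (θ₁·δ_P + θ₂)·G₀)`, `θ₁ = C1F∕(8S_j∕5)`, `θ₂ = C2X∕(8S_j∕5)²` — first differences of `h_□` against covariant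
FIRST differences of `A`, second differences and the holonomy defect against values: «of the order O(M⁻¹), or O(M⁻²), if considered on a proper scale».
[cite: Balaban1985BackgroundPropagators, p.414 l.1–3, (3.100) p.413, (3.89) p.409; Balaban1984PropagatorsII, p.247] -/
theorem norm_cutCommR_gradY_divY_hTY_apply_le_grad (c : ↥(cubes i.D.toDomains)) (U : CfgY 𝔸 i)
    (hU : ∀ μ x, ‖(U μ x : 𝔸)‖ ≤ 1 ∧ ‖(((U μ x)⁻¹ : 𝔸ˣ) : 𝔸)‖ ≤ 1) {δP : ℝ} (hδP : 0 ≤ δP)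
    (hP : ∀ (μ lam : Fin (d + 1)) (w : SiteY i) (Y : 𝔸), ‖R (plaqU (shiftY i) (UboxY i U) μ lam w) Y - Y‖ ≤ δP * ‖Y‖)
    (A : FBondY i → 𝔸) (b : FBondY i) {G₀ G₁ : ℝ}
    (hA₀ : ∀ μ, ‖bondCompY i μ A ((shiftY i μ).symm (chartY i b.src))‖ ≤ G₀
      ∧ ‖bondCompY i μ A (shiftY i b.dir ((shiftY i μ).symm (chartY i b.src)))‖ ≤ G₀)
    (hA₁ : ∀ μ, ‖cdS i U b.dir (bondCompY i μ A) ((shiftY i μ).symm (chartY i b.src))‖ ≤ G₁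
      ∧ ‖cdsS i U μ (bondCompY i μ A) (shiftY i b.dir (chartY i b.src))‖ ≤ G₁) :
    ‖cutCommR (hBdY i (hTY i c)) (hBdY i (hTY i c)) (gradY i U ∘ₗ divY i U) A b‖
      ≤ i.cf ^ 2 * (((d : ℝ) + 1) * (2 * (C1F d ℓ / (8 / 5 * (bigSide ℓ i.Mh c.1.1 : ℝ))) * G₁
          + (C1F d ℓ / (8 / 5 * (bigSide ℓ i.Mh c.1.1 : ℝ)) * δP + C2X d ℓ / (8 / 5 * (bigSide ℓ i.Mh c.1.1 : ℝ)) ^ 2) * G₀)) := by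
  have hθ₁ : 0 ≤ C1F d ℓ / (8 / 5 * (bigSide ℓ i.Mh c.1.1 : ℝ)) := div_nonneg (C1F_nonneg d ℓ) (by positivity)
  have hθ₂ : 0 ≤ C2X d ℓ / (8 / 5 * (bigSide ℓ i.Mh c.1.1 : ℝ)) ^ 2 := div_nonneg (C2X_bounds d ℓ).2.2 (by positivity)
  rw [cutCommR_gradY_divY_apply, norm_smul]
  have hc2 : ‖((i.cf ^ 2 : ℝ) : ℂ)‖ = i.cf ^ 2 := by rw [Complex.norm_real, Real.norm_eq_abs, abs_of_nonneg (sq_nonneg _)]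
  rw [hc2]
  refine mul_le_mul_of_nonneg_left ?_ (sq_nonneg _)
  -- each summand: `h(x)•X − Y(hΛ) = −(Y(hΛ) − h(x)•X)`
  have per : ∀ μ : Fin (d + 1),
      ‖((hTY i c (chartY i b.src) : ℝ) : ℂ) • cdS i U b.dir (cdsS i U μ (bondCompY i μ A)) (chartY i b.src)
          - cdS i U b.dir (cdsS i U μ (cutMulY (hTY i c) (bondCompY i μ A))) (chartY i b.src)‖
        ≤ 2 * (C1F d ℓ / (8 / 5 * (bigSide ℓ i.Mh c.1.1 : ℝ))) * G₁
          + (C1F d ℓ / (8 / 5 * (bigSide ℓ i.Mh c.1.1 : ℝ)) * δP + C2X d ℓ / (8 / 5 * (bigSide ℓ i.Mh c.1.1 : ℝ)) ^ 2) * G₀ := by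
    intro μ
    rw [← norm_neg, neg_sub]
    refine (norm_grad_term_le i c U hU hδP hP μ b.dir (bondCompY i μ A) (chartY i b.src)).trans ?_
    have e1 := (hA₁ μ).2
    have e2 := (hA₁ μ).1
    have e3 := (hA₀ μ).2
    have e4 := (hA₀ μ).1
    have t1 : C1F d ℓ / (8 / 5 * (bigSide ℓ i.Mh c.1.1 : ℝ)) * ‖cdsS i U μ (bondCompY i μ A) (shiftY i b.dir (chartY i b.src))‖
        ≤ C1F d ℓ / (8 / 5 * (bigSide ℓ i.Mh c.1.1 : ℝ)) * G₁ := mul_le_mul_of_nonneg_left e1 hθ₁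
    have t2 : C1F d ℓ / (8 / 5 * (bigSide ℓ i.Mh c.1.1 : ℝ)) * (‖cdS i U b.dir (bondCompY i μ A) ((shiftY i μ).symm (chartY i b.src))‖
          + δP * ‖bondCompY i μ A (shiftY i b.dir ((shiftY i μ).symm (chartY i b.src)))‖)
        ≤ C1F d ℓ / (8 / 5 * (bigSide ℓ i.Mh c.1.1 : ℝ)) * (G₁ + δP * G₀) :=
      mul_le_mul_of_nonneg_left (add_le_add e2 (mul_le_mul_of_nonneg_left e3 hδP)) hθ₁
    have t3 : C2X d ℓ / (8 / 5 * (bigSide ℓ i.Mh c.1.1 : ℝ)) ^ 2 * ‖bondCompY i μ A ((shiftY i μ).symm (chartY i b.src))‖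
        ≤ C2X d ℓ / (8 / 5 * (bigSide ℓ i.Mh c.1.1 : ℝ)) ^ 2 * G₀ := mul_le_mul_of_nonneg_left e4 hθ₂
    have := add_le_add (add_le_add t1 t2) t3
    refine this.trans (le_of_eq ?_)
    ring
  calc ‖∑ μ : Fin (d + 1), (((hTY i c (chartY i b.src) : ℝ) : ℂ) • cdS i U b.dir (cdsS i U μ (bondCompY i μ A)) (chartY i b.src)
          - cdS i U b.dir (cdsS i U μ (cutMulY (hTY i c) (bondCompY i μ A))) (chartY i b.src))‖
      ≤ ∑ μ : Fin (d + 1), (2 * (C1F d ℓ / (8 / 5 * (bigSide ℓ i.Mh c.1.1 : ℝ))) * G₁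
          + (C1F d ℓ / (8 / 5 * (bigSide ℓ i.Mh c.1.1 : ℝ)) * δP + C2X d ℓ / (8 / 5 * (bigSide ℓ i.Mh c.1.1 : ℝ)) ^ 2) * G₀) :=
        (norm_sum_le _ _).trans (Finset.sum_le_sum fun μ _ => per μ)
    _ = _ := by rw [Finset.sum_const, Finset.card_univ, Fintype.card_fin, nsmul_eq_mul]; push_cast; ring

end Literature.MathematicalPhysics.QuantumFieldTheory.Balaban1983to89.B9Eq3104CommutatorSizesDD

end
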